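import Summits.RiemannHypothesis.RiemannHypothesis.Theorems.WeilFormatCEntrySesq
import Summits.RiemannHypothesis.RiemannHypothesis.Theorems.WeilFormatCEntryBasis
import Summits.RiemannHypothesis.RiemannHypothesis.Theorems.WeilFormatCWindowLimit
import Summits.RiemannHypothesis.RiemannHypothesis.Theorems.WeilWindowFlowWindowLipschitzStubFormDomainPos
import HarnessLib

/-!
# Format C: the RAYLEIGH door — every trigonometric window bounds the bottom from ABOVE, `ε(a) ≤ ⟨x, G x⟩ / ‖x‖²`

Helper file (`--supports stmt-RiemannHypothesis-18085`, the parity ladder / NoParityCrossing), RH-free, pure logic.  Prover A (g21 of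
unit `sr-gb-rung-a`, route GroundBarta).

The parity ladder needs, per cell `[b, c]`, an L-side `L ≤ ε_od(c)` (format-C odd-sector λ-door, `WeilFormatCOddMarginDoorA.lean`) and a
U-side `ε(b) ≤ U`.  So far the U-sides are Rayleigh–Ritz A-LAYER certificates of one Legendre trial vector (`…Upper83Sharp`,
`…Upper865Sharp`: 7 modules per window, limited near `a = 1` by the killing-constant bracket `1.1·10⁻²⁵` and the degree-54 basis).  This
file gives the U-side a FORMAT-C route at zero new kernel machinery: the tree's form-domain inequality `stub_formDomainPos`
(`(M_a + ε(a))‖f‖² ≤ P(f) + 𝓔_a(f)` for `L²` functions vanishing off the window with finite archimedean energy — Fukushima–Oshima–Takeda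
density of `C_c^∞` in the form domain, landed by route WeilWindowFlow) applies to every WINDOW FUNCTION, in particular to the trigonometric
windows `Σ c_n χ_n`, whose window form is the Gram form of Yoshida's matrix `gramCoeff a` (`weilWindowForm_sum_smul_chi`,
`weilWindowSesq_chi`) and whose norm is `Σ |c_n|²` (`integral_norm_sq_sum_smul_chi`):

* `weilGroundEnergy_mul_le_weilWindowForm` : `ε(a)·∫‖u‖² ≤ weilWindowForm a u` for every window function `u`;
* `weilGroundEnergy_mul_le_gram` / `…_le_real_gramCoeff` : `ε(a)·Σ|c_n|² ≤ Re Σ c_m conj(c_n) G(m,n)` and, for REAL vectors,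
  `ε(a)·Σ x_n² ≤ Σ x_m x_n gramCoeff a m n`;
* `weilGroundEnergy_le_rayleigh` : `ε(a) ≤ (Σ x_m x_n gramCoeff a m n) / Σ x_n²` (`Σ x_n² > 0`).

A format-C U-side at a window `a` is therefore ONE rational test vector `x` on `modes N` (the numerically lowest eigenvector of the certified
Gram block) plus an interval evaluation of `Σ x_m x_n G(m,n)` from weil-2's entry tables — the same tables as the sector certificates, so
the U- and L-sides of a cell share their data; precision is the tables' (`2⁻¹²⁶…`), with no killing-constant floor.
Standard axioms; nothing is defined; no RH claim.
-/

set_option autoImplicit false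
-- `Summit.RiemannHypothesis.RiemannHypothesis.…` is the layout-mandated namespace (summit = problem name).
set_option linter.dupNamespace false

noncomputable section

open Complex Filter Set MeasureTheory Finset
open scoped Real Topology ComplexConjugate BigOperators

namespace Summit.RiemannHypothesis.RiemannHypothesis.Theorems.WeilFormatC

open Literature.NumberTheory.LFunctions
open Literature.NumberTheory.LFunctions.Yoshida1992 (modes chi gramCoeff)

variable {a : ℝ}

/-- A window function is in `L²`. [folklore] -/
theorem IsWindowFunction.memLp_two {u : ℝ → ℂ} (hu : IsWindowFunction a u) : MemLp u 2 volume := by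
  obtain ⟨S, hS⟩ := hu.bounded
  have hind : u = (Icc (-a) a).indicator u := by
    funext x
    by_cases hx : x ∈ Icc (-a) a
    · rw [indicator_of_mem hx]
    · rw [indicator_of_notMem hx, hu.eq_zero x hx]
  rw [hind, memLp_indicator_iff_restrict measurableSet_Icc]
  exact MemLp.of_bound hu.measurable.aestronglyMeasurable S (Eventually.of_forall fun x ↦ hS x)

/-- **The bottom bounds the window form of every window function from below**:
`ε(a) · ∫‖u‖² ≤ weilWindowForm a u` (`a > 0`; form-domain density, `stub_formDomainPos`). [folklore] -/
theorem weilGroundEnergy_mul_le_weilWindowForm (ha : 0 < a) {u : ℝ → ℂ} (hu : IsWindowFunction a u) :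
    weilGroundEnergy a * ∫ x : ℝ, ‖u x‖ ^ 2 ≤ weilWindowForm a u := by
  obtain ⟨S, hS⟩ := hu.bounded
  obtain ⟨L, hL⟩ := hu.lipschitz
  have harch := integrableOn_weilArchDensity_mul_weilIncrement_window ha.le hu.measurable hu.eq_zero hS hL
  have key := WeilWindowFlowWindowLipschitz.stub_formDomainPos a ha u hu.memLp_two
    (Eventually.of_forall hu.eq_zero) harch
  unfold weilWindowForm
  rw [add_mul] at key
  linarith

/-- **The Rayleigh door (Gram form).** For `a > 0`, every `N` and all coefficients `c : ℤ → ℂ`: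
`ε(a) · Σ_{|n|≤N} |c_n|² ≤ Re Σ_{m,n} c_m conj(c_n) G(m,n)`, `G(m,n) = weilWindowSesq a χ_m χ_n`. [folklore] -/
theorem weilGroundEnergy_mul_le_gram (ha : 0 < a) (N : ℕ) (c : ℤ → ℂ) :
    weilGroundEnergy a * ∑ n ∈ modes N, ‖c n‖ ^ 2 ≤
      (∑ m ∈ modes N, ∑ n ∈ modes N, c m * conj (c n) * weilWindowSesq a (chi a m) (chi a n)).re := by
  have hwin : IsWindowFunction a (∑ n ∈ modes N, c n • chi a n) :=
    ⟨measurable_sum_smul_chi _ _, fun x hx ↦ sum_smul_chi_eq_zero _ _ hx, ⟨_, norm_sum_smul_chi_le _ _⟩,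
      ⟨_, fun x y hx hy ↦ norm_sum_smul_chi_sub_le ha _ _ hx hy⟩⟩
  have h := weilGroundEnergy_mul_le_weilWindowForm ha hwin
  rw [integral_norm_sq_sum_smul_chi ha (modes N) c,
    weilWindowForm_sum_smul_eq_re ha.le (modes N) (fun n _ ↦ isWindowFunction_chi ha n) c a] at h
  exact h

/-- **The Rayleigh door (real Gram form, explicit matrix).** For `a > 0`, every `N` and every REAL vector `x : ℤ → ℝ`:
`ε(a) · Σ_{|n|≤N} x_n² ≤ Σ_{m,n} x_m x_n · gramCoeff a m n` (Yoshida's (5.15)/(5.16)). [folklore] -/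
theorem weilGroundEnergy_mul_le_real_gramCoeff (ha : 0 < a) (N : ℕ) (x : ℤ → ℝ) :
    weilGroundEnergy a * ∑ n ∈ modes N, x n ^ 2 ≤ ∑ m ∈ modes N, ∑ n ∈ modes N, x m * x n * gramCoeff a m n := by
  have h := weilGroundEnergy_mul_le_gram ha N (fun n ↦ (x n : ℂ))
  have e1 : ∑ n ∈ modes N, ‖((x n : ℝ) : ℂ)‖ ^ 2 = ∑ n ∈ modes N, x n ^ 2 :=
    Finset.sum_congr rfl fun n _ ↦ by rw [Complex.norm_real, Real.norm_eq_abs, sq_abs]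
  have e2 : (∑ m ∈ modes N, ∑ n ∈ modes N, ((x m : ℝ) : ℂ) * conj ((x n : ℝ) : ℂ) * weilWindowSesq a (chi a m) (chi a n)).re =
      ∑ m ∈ modes N, ∑ n ∈ modes N, x m * x n * gramCoeff a m n := by
    rw [Complex.re_sum]
    refine Finset.sum_congr rfl fun m _ ↦ ?_
    rw [Complex.re_sum]
    refine Finset.sum_congr rfl fun n _ ↦ ?_
    rw [weilWindowSesq_chi ha, Complex.conj_ofReal]
    norm_cast
  rw [e1, e2] at h
  exact h

/-- **The Rayleigh door (quotient form).** `ε(a) ≤ (Σ_{m,n} x_m x_n gramCoeff a m n) / Σ_n x_n²` for every real vector with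
`Σ x_n² > 0` — a format-C UPPER bound on the bottom of the window from one test vector. [folklore] -/
theorem weilGroundEnergy_le_rayleigh (ha : 0 < a) (N : ℕ) (x : ℤ → ℝ) (hx : 0 < ∑ n ∈ modes N, x n ^ 2) :
    weilGroundEnergy a ≤ (∑ m ∈ modes N, ∑ n ∈ modes N, x m * x n * gramCoeff a m n) / ∑ n ∈ modes N, x n ^ 2 := by
  rw [le_div_iff₀ hx]
  exact weilGroundEnergy_mul_le_real_gramCoeff ha N x

/-- **U-side from an enclosure.** If some real test vector on `modes N` has `Σ x_m x_n G(m,n) ≤ U · Σ x_n²` (e.g. by an interval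
evaluation of the Gram form on certified entry tables), then `ε(a) ≤ U`. [folklore] -/
theorem weilGroundEnergy_le_of_gram_test (ha : 0 < a) (N : ℕ) (x : ℤ → ℝ) (hx : 0 < ∑ n ∈ modes N, x n ^ 2) {U : ℝ}
    (hU : ∑ m ∈ modes N, ∑ n ∈ modes N, x m * x n * gramCoeff a m n ≤ U * ∑ n ∈ modes N, x n ^ 2) :
    weilGroundEnergy a ≤ U :=
  le_of_mul_le_mul_right ((weilGroundEnergy_mul_le_real_gramCoeff ha N x).trans hU) hx

end Summit.RiemannHypothesis.RiemannHypothesis.Theorems.WeilFormatC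

end
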